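import Mathlib
import HarnessLib
import Summits.HubbardSuperconductivity.HubbardSuperconductivity.Theses.NodalWardXY
import Literature.MathematicalPhysics.QuantumLattice.BdGBondHamiltonianTorus

/-!
# Sketch — crux-ideate stmt-HubbardSuperconductivity-1266 (`NodalWardXY.VisonPairCost`), ideator 1, round 1

First lemmas / transfer statements of the three idea cards
`idea-sommerfeld-cover-heat-trace.md` (A), `idea-vison-force-krein.md` (B), `idea-nambu-smearing-ward.md` (C).
Everything here only has to ELABORATE (no proofs claimed except `rfl`-level bookkeeping).
-/

noncomputable section

namespace Summit.HubbardSuperconductivity.HubbardSuperconductivity.Cruxes.VisonPairCost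

open scoped BigOperators Matrix
open Literature.Probability.LatticeModels Literature.MathematicalPhysics.QuantumLattice
open Summit.HubbardSuperconductivity.HubbardSuperconductivity.Theses.NodalWardXY

/-! ## The crux's Fock-space Hamiltonian, named (verbatim copy of the `let H` of `VisonPairCost`) -/

/-- `visonH L μ Δ₀ R` = the `H R` of the crux: lattice `d`-wave BdG Hamiltonian on `(ℤ/Lℤ)²` with the `ℤ₂` string
`s_R = -1` on the vertical bonds leaving `(a,0)`, `a < R`. -/
def visonH (L : ℕ) [NeZero L] (μ Δ₀ : ℝ) (R : ℕ) :
    Matrix (Finset (Orb (FermionTorus 2 L))) (Finset (Orb (FermionTorus 2 L))) ℂ :=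
  let c : TorusSite 2 L → Fin 2 → Matrix (Finset (Orb (FermionTorus 2 L))) (Finset (Orb (FermionTorus 2 L))) ℂ :=
    fun y σ => annihilation (orb (FermionTorus.ofTorusSite y) σ)
  (∑ x : TorusSite 2 L, ∑ i : Fin 2, (if i = 1 ∧ x 1 = 0 ∧ (x 0).val < R then (-1 : ℂ) else 1) •
    ((∑ σ : Fin 2, -((c x σ)ᴴ * c (x + Pi.single i 1) σ + (c (x + Pi.single i 1) σ)ᴴ * c x σ)) +
      ((Δ₀ * (if i = 0 then (1 : ℝ) else -1) : ℝ) : ℂ) •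
        ((c x 0 * c (x + Pi.single i 1) 1 - c x 1 * c (x + Pi.single i 1) 0) +
          (c x 0 * c (x + Pi.single i 1) 1 - c x 1 * c (x + Pi.single i 1) 0)ᴴ))) -
    (μ : ℂ) • totalNumber

/-- Read-back: the crux is literally the uniform bound on `visonH` ground energies. -/
theorem visonPairCost_iff :
    VisonPairCost ↔
      ∀ μ : ℝ, μ ∈ Set.Ioo (-4 : ℝ) 4 → μ ≠ 0 → ∀ Δ₀ : ℝ, 0 < Δ₀ → ∃ C : ℝ, ∀ (L : ℕ) [NeZero L], 4 ≤ L →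
        ∀ R : ℕ, 2 * R ≤ L → |(visonH L μ Δ₀ R).groundEnergy - (visonH L μ Δ₀ 0).groundEnergy| ≤ C :=
  Iff.rfl

/-! ## Card C — first lemma: the two-sided LOG bound (optimal `U(1)`-smearing + variational squeeze + time reversal) -/

/-- `VisonPairCostLog`: the log-bounded weakening of the crux (kill criterion K1's fallback), claimed PROVABLE NOW:
`|E₀(H(R)) - E₀(H(0))| ≤ C (1 + log (1 + R))` for `2R ≤ L` (so `min(R, L-R) = R`). -/
def VisonPairCostLog : Prop :=
  ∀ μ : ℝ, μ ∈ Set.Ioo (-4 : ℝ) 4 → ∀ Δ₀ : ℝ, 0 ≤ Δ₀ → ∃ C : ℝ, ∀ (L : ℕ) [NeZero L], 4 ≤ L →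
    ∀ R : ℕ, 2 * R ≤ L →
      |(visonH L μ Δ₀ R).groundEnergy - (visonH L μ Δ₀ 0).groundEnergy| ≤ C * (1 + Real.log (1 + R))

/-- The abstract squeeze behind it (finite-dimensional, provable now from `groundEnergy_le_rayleigh` +
`groundEnergy_unitary_conj`): if `U H₁ Uᴴ - H₀` has vanishing expectation-of-odd-part in ground states — packaged as:
for Hermitian `H₀, K` and a unitary `U` with `U H₁ Uᴴ = H₀ + K`, `E₀(H₁) - E₀(H₀) ≤ ⟨ψ₀, K ψ₀⟩` for every normalised
ground vector `ψ₀` of `H₀`. (Applied twice, with the dia/para split `K = (cos A - 1)·even + sin A·current` and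
`⟨current⟩ = 0` in real ground states, it gives `VisonPairCostLog` with `C ∝ inf_A Σ_b (1 - cos A_b) ~ π log R`.) -/
def VariationalSqueeze : Prop :=
  ∀ (n : Type) [Fintype n] [DecidableEq n] (H₀ H₁ K U : Matrix n n ℂ), H₀.IsHermitian → H₁.IsHermitian →
    U ∈ Matrix.unitaryGroup n ℂ → U * H₁ * Uᴴ = H₀ + K →
    ∀ ψ₀ : n → ℂ, star ψ₀ ⬝ᵥ ψ₀ = 1 → (star ψ₀ ⬝ᵥ H₀ *ᵥ ψ₀).re = H₀.groundEnergy →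
      H₁.groundEnergy - H₀.groundEnergy ≤ (star ψ₀ ⬝ᵥ K *ᵥ ψ₀).re

/-! ## Card B — transfer: summable decay of the vison FORCE (one bond flip per step) -/

/-- `VisonForceDecay` (C⁺ of card B): moving one vison by one plaquette changes the ground energy by a summable amount,
`|E₀(H(R+1)) - E₀(H(R))| ≤ C ((R+1)^{-(1+ε)} + L⁻¹)`. Telescoping + `|E₀(H(1)) - E₀(H(0))| = O(1)` (one flipped bond,
Weyl) gives `VisonPairCost` with constant `C (ζ(1+ε) + 1/2) + O(1)`. Expected truth: `ε = 1` (Casimir force `~ R⁻²`). -/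
def VisonForceDecay : Prop :=
  ∀ μ : ℝ, μ ∈ Set.Ioo (-4 : ℝ) 4 → μ ≠ 0 → ∀ Δ₀ : ℝ, 0 < Δ₀ → ∃ C ε : ℝ, 0 < ε ∧ ∀ (L : ℕ) [NeZero L], 4 ≤ L →
    ∀ R : ℕ, 2 * (R + 1) ≤ L →
      |(visonH L μ Δ₀ (R + 1)).groundEnergy - (visonH L μ Δ₀ R).groundEnergy| ≤
        C * (((R : ℝ) + 1) ^ (-(1 + ε)) + (L : ℝ)⁻¹)

/-- The telescoping glue of card B, as a statement (pure real analysis + Weyl's inequality for the first step). -/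
def ForceDecayGlue : Prop := VisonForceDecay → VisonPairCost

/-- Card B, REPAIRED transfer after the toy job j006754 (2026-08-16): the computed force OSCILLATES in sign with the
inter-node wavevectors (period `≈ π/p_F` in `R`) with an envelope between `1/R` and `1/R²` that `L ≤ 48` cannot separate from
the `O(1/L)` finite-size floor — dimensional analysis for a pair of MARGINAL (scale-free) defects predicts
`E_int(R) ∋ cos(κR + φ)/R`, i.e. an oscillating force of envelope `1/R`, so ABSOLUTE summability (`VisonForceDecay`) is
doubtful. The natural output of the local determinant formula is instead an oscillatory force LAW: finitely many
non-resonant frequencies `κ_j` (`e^{iκ_j} ≠ 1`; expected `κ ∈ {2p_F, …}`, `cos p_F = -μ/4`) with `1/R` envelope plus an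
absolutely summable remainder. -/
def VisonForceAsymptotics : Prop :=
  ∀ μ : ℝ, μ ∈ Set.Ioo (-4 : ℝ) 4 → μ ≠ 0 → ∀ Δ₀ : ℝ, 0 < Δ₀ →
    ∃ (n : ℕ) (a : Fin n → ℂ) (κ : Fin n → ℝ) (C ε : ℝ), (∀ j, Complex.exp (Complex.I * (κ j : ℂ)) ≠ 1) ∧ 0 < ε ∧
      ∀ (L : ℕ) [NeZero L], 4 ≤ L → ∀ R : ℕ, 2 * (R + 1) ≤ L →
        |(visonH L μ Δ₀ (R + 1)).groundEnergy - (visonH L μ Δ₀ R).groundEnergy -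
            (∑ j, a j * Complex.exp (Complex.I * (κ j : ℂ) * (R : ℂ))).re / ((R : ℝ) + 1)| ≤
          C * (((R : ℝ) + 1) ^ (-(1 + ε)) + (L : ℝ)⁻¹)

/-- Abel-summation glue: bounded partial sums of `Σ_k e^{iκk}/(k+1)` (`≤ 2/|1 - e^{iκ}|`), `p`-series for the remainder,
`Σ_{k<L/2} L⁻¹ ≤ ½`, and `SingleFlipBound` for the first step. Pure bookkeeping. -/
def ForceAsymptoticsGlue : Prop := VisonForceAsymptotics → VisonPairCost

/-- Card B, step zero (provable now, Weyl/Rayleigh: `|E₀(A + W) - E₀(A)| ≤ ‖W‖`, one flipped bond has Fock operator norm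
`≤ 2(2 + 2Δ₀)`): a single vison hop costs `O(1)` uniformly — the string bound per unit length, and the `R = 0 → 1` step. -/
def SingleFlipBound : Prop :=
  ∀ (L : ℕ) [NeZero L], 4 ≤ L → ∀ (μ Δ₀ : ℝ), 0 ≤ Δ₀ → ∀ R : ℕ,
    |(visonH L μ Δ₀ (R + 1)).groundEnergy - (visonH L μ Δ₀ R).groundEnergy| ≤ 4 * (1 + Δ₀)

/-! ## Card A — the Sommerfeld double cover: one-body Nambu matrices, the splitting isometry, heat-trace transfer -/

section OneBody

variable (L : ℕ) [NeZero L]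

/-- String indicator of the crux's `ℤ₂` gauge field: the bond `(x, x + e_i)` is crossed iff `i = 1`, `x₁ = 0`, `x₀ < R`. -/
def cross (R : ℕ) (x : TorusSite 2 L) (i : Fin 2) : Bool :=
  decide (i = 1 ∧ x 1 = 0 ∧ (x 0).val < R)

/-- The `ℤ₂` bond sign `s_R(x,i) = -1` on crossed bonds, `+1` otherwise. -/
def bondSign (R : ℕ) (x : TorusSite 2 L) (i : Fin 2) : ℝ :=
  if cross L R x i then -1 else 1

/-- Nambu `2×2` bond block in direction `i` (basis `ψ_x = (c_{x↑}, c†_{x↓})`): particle hopping `-1`, hole hopping `+1`,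
`d`-wave pairing `-Δ₀ gᵢ` off-diagonal, `g = (+1,-1)`. -/
def bondBlock (Δ₀ : ℝ) (i : Fin 2) : Matrix (Fin 2) (Fin 2) ℝ :=
  !![-1, -(Δ₀ * (if i = 0 then 1 else -1)); -(Δ₀ * (if i = 0 then 1 else -1)), 1]

/-- Nambu on-site block `-μ τ_z`. -/
def onsiteBlock (μ : ℝ) : Matrix (Fin 2) (Fin 2) ℝ := !![-μ, 0; 0, μ]

/-- The one-body Nambu (BdG) matrix `𝔻_R` of `visonH L μ Δ₀ R` on `(ℤ/Lℤ)² × {particle, hole}` (real symmetric,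
`2L² × 2L²`): `visonH = ψ† 𝔻_R ψ - μ L²`, so `E₀(visonH R) = -μL² - ½ Σₙ |λₙ(𝔻_R)|`. -/
def nambuD (R : ℕ) (μ Δ₀ : ℝ) : Matrix (TorusSite 2 L × Fin 2) (TorusSite 2 L × Fin 2) ℝ :=
  Matrix.of fun p q =>
    (if p.1 = q.1 then onsiteBlock μ p.2 q.2 else 0) +
      ∑ i : Fin 2, ((if q.1 = p.1 + Pi.single i 1 then bondSign L R p.1 i * bondBlock Δ₀ i p.2 q.2 else 0) +
        (if p.1 = q.1 + Pi.single i 1 then bondSign L R q.1 i * bondBlock Δ₀ i p.2 q.2 else 0))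

/-- The FLUX-FREE one-body matrix on the two-sheeted cover of the torus branched at the two vison plaquettes: sheets
`s ∈ Bool`, a bond changes sheet iff it crosses the string. No signs anywhere. -/
def coverD (R : ℕ) (μ Δ₀ : ℝ) :
    Matrix ((TorusSite 2 L × Bool) × Fin 2) ((TorusSite 2 L × Bool) × Fin 2) ℝ :=
  Matrix.of fun P Q =>
    (if P.1 = Q.1 then onsiteBlock μ P.2 Q.2 else 0) +
      ∑ i : Fin 2,
        ((if Q.1.1 = P.1.1 + Pi.single i 1 ∧ Q.1.2 = Bool.xor P.1.2 (cross L R P.1.1 i) then bondBlock Δ₀ i P.2 Q.2 else 0) +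
          (if P.1.1 = Q.1.1 + Pi.single i 1 ∧ P.1.2 = Bool.xor Q.1.2 (cross L R Q.1.1 i) then bondBlock Δ₀ i P.2 Q.2 else 0))

/-- The deck-parity change of basis: column `inl (y,b)` = odd combination of the two lifts of `(y,b)` (↦ `𝔻_R`),
column `inr (y,b)` = even combination (↦ `𝔻_0`). -/
def coverSplit : Matrix ((TorusSite 2 L × Bool) × Fin 2) ((TorusSite 2 L × Fin 2) ⊕ (TorusSite 2 L × Fin 2)) ℝ :=
  Matrix.of fun P j =>
    match j with
    | Sum.inl q => if P.1.1 = q.1 ∧ P.2 = q.2 then (if P.1.2 then -1 else 1) / Real.sqrt 2 else 0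
    | Sum.inr q => if P.1.1 = q.1 ∧ P.2 = q.2 then 1 / Real.sqrt 2 else 0

/-- The nearest-neighbour graph of the branched double cover (for Gaussian bounds in the cover metric). -/
def coverGraph (R : ℕ) : SimpleGraph (TorusSite 2 L × Bool) :=
  SimpleGraph.fromRel fun p q => ∃ i : Fin 2, q.1 = p.1 + Pi.single i 1 ∧ q.2 = Bool.xor p.2 (cross L R p.1 i)

end OneBody

/-- **First lemma of card A (`CoverSplitting`)** — the `ℤ₂` flux pair is the odd deck-sector of the flux-free cover:
`Wᵀ 𝔻̃ W = 𝔻_R ⊕ 𝔻_0` with `W = coverSplit` orthogonal. Finite bookkeeping, provable now (`ext` + cases). Consequences: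
`Σ|λ(𝔻̃)| = Σ|λ(𝔻_R)| + Σ|λ(𝔻_0)|`, `Tr e^{-s𝔻̃²} = Tr e^{-s𝔻_R²} + Tr e^{-s𝔻_0²}`, and the method of images
`K_R(x,x) - K_0(x,x) = -2 K̃((x,0),(x,1))`. -/
def CoverSplitting : Prop :=
  ∀ (L : ℕ) [NeZero L], 4 ≤ L → ∀ (R : ℕ) (μ Δ₀ : ℝ),
    (coverSplit L)ᵀ * coverD L R μ Δ₀ * coverSplit L = Matrix.fromBlocks (nambuD L R μ Δ₀) 0 0 (nambuD L 0 μ Δ₀) ∧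
      (coverSplit L)ᵀ * coverSplit L = 1 ∧ coverSplit L * (coverSplit L)ᵀ = 1

/-- The BdG ground-energy trace formula linking the crux's Fock-space energy to the one-body matrix (infrastructure stub,
shared by every BdG card; Bogoliubov/particle–hole transformation on `↓`):
`E₀(visonH R) = -μ L² - ½ Σₙ |λₙ(𝔻_R)|`. Stated with the Hermiticity witness as a binder. -/
def GroundEnergyTraceFormula : Prop :=
  ∀ (L : ℕ) [NeZero L], 4 ≤ L → ∀ (R : ℕ) (μ Δ₀ : ℝ) (hD : (nambuD L R μ Δ₀).IsHermitian),
    (visonH L μ Δ₀ R).groundEnergy = -μ * (L : ℝ) ^ 2 - (1 / 2) * ∑ p, |hD.eigenvalues p|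

/-- The heat-trace representation of the cost (exact for finite Hermitian matrices of equal size:
`Σ|λ(A)| - Σ|λ(B)| = -(1/(2√π)) ∫₀^∞ s^{-3/2} (Tr e^{-sA²} - Tr e^{-sB²}) ds`), as it will be used: -/
def HeatTraceFormula : Prop :=
  ∀ (n : Type) [Fintype n] [DecidableEq n] (A B : Matrix n n ℝ) (hA : A.IsHermitian) (hB : B.IsHermitian),
    ∑ i, |hA.eigenvalues i| - ∑ i, |hB.eigenvalues i| =
      -(1 / (2 * Real.sqrt Real.pi)) * ∫ s in Set.Ioi (0 : ℝ), s ^ (-(3 : ℝ) / 2) *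
        ((NormedSpace.exp (-(s • (A * A)))).trace - (NormedSpace.exp (-(s • (B * B)))).trace)

/-- **Transfer of card A (`HeatTraceBound`, C⁺_A)**: the heat-trace difference of the squared BdG operators with and
without the vison pair is bounded uniformly in `(L, R, s)`, with the trivial locality rate at small `s`:
`|Tr e^{-s𝔻_R²} - Tr e^{-s𝔻_0²}| ≤ C min(s, 1)`. With `GroundEnergyTraceFormula` and `HeatTraceFormula` it gives
`VisonPairCost` with constant `(1/(4√π)) (∫₀¹ s^{-1/2} C ds + ∫₁^∞ s^{-3/2} C ds) = C/√π`. -/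
def HeatTraceBound : Prop :=
  ∀ μ : ℝ, μ ∈ Set.Ioo (-4 : ℝ) 4 → μ ≠ 0 → ∀ Δ₀ : ℝ, 0 < Δ₀ → ∃ C : ℝ, ∀ (L : ℕ) [NeZero L], 4 ≤ L →
    ∀ R : ℕ, 2 * R ≤ L → ∀ s : ℝ, 0 < s →
      |(NormedSpace.exp (-(s • (nambuD L R μ Δ₀ * nambuD L R μ Δ₀)))).trace -
          (NormedSpace.exp (-(s • (nambuD L 0 μ Δ₀ * nambuD L 0 μ Δ₀)))).trace| ≤ C * min s 1

/-- **The engine behind C⁺_A (`CoverGaussianBound`)**: Gaussian heat-kernel upper bound for `e^{-s𝔻̃²}` on the branched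
cover, in the cover's graph metric, uniformly in `(L, R)` — to be obtained from a 4-valley Gagliardo–Nirenberg/Nash
inequality for `𝔻̃²` (local gauge identification with the base + a Hardy inequality at the two cone points for the odd
sector) and Davies' exponential-weight perturbation (2D, `L²` methods, no positivity). Summing `(C/s) e^{-c (2r)²/s}`
over the annuli around the two branch points gives `HeatTraceBound` for `s ≥ 1`. -/
def CoverGaussianBound : Prop :=
  ∀ μ : ℝ, μ ∈ Set.Ioo (-4 : ℝ) 4 → μ ≠ 0 → ∀ Δ₀ : ℝ, 0 < Δ₀ → ∃ C c : ℝ, 0 < c ∧ ∀ (L : ℕ) [NeZero L], 4 ≤ L →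
    ∀ R : ℕ, 2 * R ≤ L → ∀ s : ℝ, 1 ≤ s → ∀ P Q : (TorusSite 2 L × Bool) × Fin 2,
      |(NormedSpace.exp (-(s • (coverD L R μ Δ₀ * coverD L R μ Δ₀)))) P Q| ≤
        C * (1 / s + 1 / (L : ℝ) ^ 2) * Real.exp (-(c * ((coverGraph L R).dist P.1 Q.1 : ℝ) ^ 2 / s))

/-- **Card B's exact local formula (`ForceDeterminantFormula`)**: one vison hop = a rank-4 one-body perturbation
`V = 𝔻_{R+1} - 𝔻_R` (the flipped bond), and by `Tr(A²+t²)⁻¹ = (2t)⁻¹ ∂ₜ log det(A²+t²)`, `det((A+V)²+t²)/det(A²+t²) =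
|det(1 + V(A - it)⁻¹)|²` and an integration by parts (`Tr V = 0` kills the boundary term):
`Σ|λ(𝔻_{R+1})| - Σ|λ(𝔻_R)| = (2/π) ∫₀^∞ log|det(1 + V (𝔻_R - it)⁻¹)| dt` — a `4 × 4` determinant of the CORE Green's matrix
at imaginary frequency (finite rank), i.e. `F_L(R) = E₀(H(R+1)) - E₀(H(R)) = -(1/π)∫₀^∞ log|det₄(1 + V₄ g_{L,R}(it))| dt`. -/
def ForceDeterminantFormula : Prop :=
  ∀ (L : ℕ) [NeZero L], 4 ≤ L → ∀ (R : ℕ) (μ Δ₀ : ℝ) (hR : (nambuD L R μ Δ₀).IsHermitian)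
    (hR' : (nambuD L (R + 1) μ Δ₀).IsHermitian),
    ∑ p, |hR'.eigenvalues p| - ∑ p, |hR.eigenvalues p| =
      (2 / Real.pi) * ∫ t in Set.Ioi (0 : ℝ),
        Real.log ‖((1 : Matrix (TorusSite 2 L × Fin 2) (TorusSite 2 L × Fin 2) ℂ) +
          ((nambuD L (R + 1) μ Δ₀ - nambuD L R μ Δ₀).map Complex.ofReal) *
            ((nambuD L R μ Δ₀).map Complex.ofReal - ((t : ℂ) * Complex.I) • (1 : Matrix _ _ ℂ))⁻¹).det‖

/-- The chain of card A, as statements. -/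
def CoverChain : Prop :=
  (CoverGaussianBound → HeatTraceBound) ∧
    (CoverSplitting → HeatTraceFormula → GroundEnergyTraceFormula → HeatTraceBound → VisonPairCost)

end Summit.HubbardSuperconductivity.HubbardSuperconductivity.Cruxes.VisonPairCost
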